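import Mathlib
import HarnessLib
import Summits.CriticalPhenomena.PercolationContinuityZ3.Theses.PercGamblersRuin
import Literature.Probability.Percolation.ConstrainedClusters
import Literature.Probability.Percolation.SiteConnectionTools
import Literature.Probability.Percolation.UniquenessInfiniteCluster

/-!
# `SymmetricSlabCalibration` — the symmetric slab voltage carries at least half the mass of `{0 ↔ ∞}`

Route `PercGamblersRuin` of `PercolationContinuityZ3`, support item stmt-CriticalPhenomena-10643
(`Summit.CriticalPhenomena.PercolationContinuityZ3.Theses.PercGamblersRuin.SymmetricSlabCalibration`).

Statement proved: for every `p ∈ [0,1]`, every `n > 0` and every selection `v : Ω → ℤ³ → ℝ` with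
`ω ↦ v ω 0` measurable, `0 ≤ v ≤ 1`, `v ω x = 1` on the ceiling `{n ≤ x₀}`, `v ω x = 0` on the
floor `{x₀ ≤ -n}` and harmonic for the open lattice edges of `ω` at every site of the open slab
`S = {-n < x₀ < n}`,
`(θ(p) - P_p(0 ↔ ∞ inside S)) / 2 ≤ ∫_{0 ↔ ∞} v(ω, 0) dP_p`.

Proof (Doyle–Snell style maximum principle + reflection symmetry; Lyons–Peres 2016, §2.1).
* `maxPrinciple`: for a configuration `ω` whose cluster `K` of `0` using lattice steps inside a
  region `S` is finite and has an open lattice edge leaving `S`, a function `u` vanishing off `S`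
  and harmonic on `S` for the open lattice edges is `≤ 0` on `K` (look at a maximiser on `K`;
  harmonicity forces the maximum to propagate along open steps in `S` up to the exit edge, where
  the outside value `0` contradicts positivity). Hence two functions with the same values off `S`,
  both harmonic on `S`, agree at `0` (`eq_of_harmonic`). The exit edge exists as soon as
  `ω ⊆ E(ℤ³)`, `|C(0)| = ∞` and `K` is finite (`exists_exit`,
  `SimpleGraph.Walk.exists_boundary_dart`).
* Reflection `r : x₀ ↦ -x₀` (`Site.signedPerm`, `zdSignedPermIso`) and the induced relabelling
  `R = BondConfig.relabel (sym2Equiv r)` of configurations: `x ↦ 1 - v (R ω) (r x)` is again a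
  slab voltage for `ω` (`reflect_harmonic`), so `v ω 0 + v (R ω) 0 = 1` on the event
  `A = {0 ↔ ∞} \ {0 ↔ ∞ inside S}` for `ω ⊆ E(ℤ³)` (`sum_reflect_eq_one`).
* `P_p` is `R`-invariant (`bondPercolation_map_relabel_iso`) and `A` is `R`-invariant
  (`refl_preimage_event`), so `∫_A v(·,0) = ∫_A v(R ·, 0)`, whence
  `2 ∫_A v(·,0) = P_p(A) = θ(p) - P_p(0 ↔ ∞ inside S)` (`measureReal_sdiff`; configurations use
  only lattice edges a.s., `setBernoulli_ae_subset`), and `∫_{0 ↔ ∞} v ≥ ∫_A v` as `v ≥ 0`.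
The subtracted event of the statement, `{ω | ω ∩ E_S ∈ percolatesAt 0}` with `E_S` the lattice
edges with both endpoints in `S`, is literally `percolatesVia (withinGraph (zdGraph 3) S) 0`
(`edgeSet_slab`, `slabEvent_eq`).
-/

noncomputable section

namespace Summit.CriticalPhenomena.PercolationContinuityZ3.Theorems

open MeasureTheory Filter Literature.Probability.Percolation Literature.Probability.LatticeModels
open scoped Classical

namespace SymmetricSlab

/-! ### The reflection `x₀ ↦ -x₀` -/

/-- The reflection `x₀ ↦ -x₀` (`Site.signedPerm` with trivial permutation and sign `-1` on the
first axis) negates the height coordinate. -/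
theorem refl_apply_zero (x : Site 3) :
    (Site.signedPerm (d := 3) (Equiv.refl (Fin 3)) (Function.update 1 0 (-1)) x) 0 = -(x 0) := by
  simp only [Site.signedPerm_apply, Function.update_self, Equiv.refl_symm, Equiv.refl_apply,
    Units.val_neg, Units.val_one, neg_mul, one_mul]

/-- The reflection `x₀ ↦ -x₀` is a lattice automorphism of `ℤ³` (`zdSignedPermIso`). -/
theorem adj_refl_iff (x y : Site 3) :
    (zdGraph 3).Adj (Site.signedPerm (d := 3) (Equiv.refl (Fin 3)) (Function.update 1 0 (-1)) x)
        (Site.signedPerm (d := 3) (Equiv.refl (Fin 3)) (Function.update 1 0 (-1)) y) ↔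
      (zdGraph 3).Adj x y :=
  (zdSignedPermIso (d := 3) (Equiv.refl (Fin 3)) (Function.update 1 0 (-1))).map_adj_iff

/-! ### The maximum principle on a finite constrained cluster -/

/-- A set of vertices closed under the steps of a graph contains the endpoint of every walk that
starts in it (contrapositive of `SimpleGraph.Walk.exists_boundary_dart`). -/
theorem mem_of_walk {V : Type*} {G : SimpleGraph V} {T : Set V}
    (hT : ∀ x ∈ T, ∀ y, G.Adj x y → y ∈ T) {c a : V} (w : G.Walk c a) (hc : c ∈ T) : a ∈ T := by
  by_contra ha
  obtain ⟨d, -, hd1, hd2⟩ := w.exists_boundary_dart T hc ha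
  exact hd2 (hT _ hd1 _ d.adj)

/-- **Maximum principle.** Let `ω` be a configuration, `K` the open cluster of `0` using lattice
steps inside the region `S ∋ 0`, assumed finite, and `u : ℤ³ → ℝ` a function vanishing off `S`
and harmonic for the open lattice edges at every site of `S`. If `K` has an open lattice edge to
a site outside `S`, then `u ≤ 0` on `K`. -/
theorem maxPrinciple {S : Set (Site 3)} (h0 : (0 : Site 3) ∈ S) {ω : BondConfig (Site 3)}
    {u : Site 3 → ℝ} (hfin : (openClusterIn (withinGraph (zdGraph 3) S) ω 0).Finite)
    (hout : ∀ y : Site 3, y ∉ S → u y = 0)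
    (hharm : ∀ x ∈ S,
      ∑ y ∈ ((zdGraph 3).neighborFinset x).filter (fun y => s(x, y) ∈ ω), (u y - u x) = 0)
    (hexit : ∃ a ∈ openClusterIn (withinGraph (zdGraph 3) S) ω 0, ∃ b ∉ S,
      (zdGraph 3).Adj a b ∧ s(a, b) ∈ ω) :
    ∀ x ∈ openClusterIn (withinGraph (zdGraph 3) S) ω 0, u x ≤ 0 := by
  have hKS : openClusterIn (withinGraph (zdGraph 3) S) ω 0 ⊆ S :=
    openClusterIn_withinGraph_subset h0 ω
  obtain ⟨m, hmK, hmax⟩ :=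
    Set.exists_max_image _ u hfin ⟨0, self_mem_openClusterIn _ ω 0⟩
  by_contra hcon
  push Not at hcon
  obtain ⟨x₁, hx₁K, hx₁⟩ := hcon
  have hMpos : 0 < u m := hx₁.trans_le (hmax x₁ hx₁K)
  -- at a maximiser, every open lattice neighbour lies in `S` and is again a maximiser
  have hP : ∀ x ∈ openClusterIn (withinGraph (zdGraph 3) S) ω 0, u x = u m → ∀ y,
      (zdGraph 3).Adj x y → s(x, y) ∈ ω → y ∈ S ∧ u y = u m := by
    intro x hxK hux y hxy hω
    have hterm : ∀ y ∈ ((zdGraph 3).neighborFinset x).filter (fun y => s(x, y) ∈ ω),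
        u y - u x ≤ 0 := by
      intro y hy
      rw [Finset.mem_filter, SimpleGraph.mem_neighborFinset] at hy
      by_cases hyS : y ∈ S
      · have hyK : y ∈ openClusterIn (withinGraph (zdGraph 3) S) ω 0 :=
          mem_openClusterIn_of_adj hxK (withinGraph_adj.2 ⟨hy.1, hKS hxK, hyS⟩) hy.2
        have := hmax y hyK
        rw [hux]
        linarith
      · rw [hout y hyS, hux]
        linarith
    have hzero := (Finset.sum_eq_zero_iff_of_nonpos hterm).1 (hharm x (hKS hxK))
    have hy0 : u y - u x = 0 := hzero y (by
      rw [Finset.mem_filter, SimpleGraph.mem_neighborFinset]; exact ⟨hxy, hω⟩)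
    by_cases hyS : y ∈ S
    · refine ⟨hyS, ?_⟩
      rw [hux] at hy0
      linarith
    · rw [hout y hyS, hux] at hy0
      linarith
  obtain ⟨a, haK, b, hbS, hab, habω⟩ := hexit
  -- the set of maximisers in `K` is closed under open steps inside `S`
  have hT : ∀ x ∈ {x | x ∈ openClusterIn (withinGraph (zdGraph 3) S) ω 0 ∧ u x = u m}, ∀ y,
      (openGraph ω ⊓ withinGraph (zdGraph 3) S).Adj x y →
        y ∈ {x | x ∈ openClusterIn (withinGraph (zdGraph 3) S) ω 0 ∧ u x = u m} := by
    rintro x ⟨hxK, hux⟩ y hxy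
    rw [SimpleGraph.inf_adj, openGraph_adj] at hxy
    exact ⟨mem_openClusterIn_of_adj hxK hxy.2 hxy.1.1,
      (hP x hxK hux y (withinGraph_adj.1 hxy.2).1 hxy.1.1).2⟩
  have hreach : (openGraph ω ⊓ withinGraph (zdGraph 3) S).Reachable m a :=
    (mem_openClusterIn_iff.1 hmK).symm.trans (mem_openClusterIn_iff.1 haK)
  obtain ⟨w⟩ := hreach
  have haT := mem_of_walk hT w ⟨hmK, rfl⟩
  exact hbS (hP a haK haT.2 b hab habω).1

/-- **Exit edge.** If `ω` uses only lattice edges, `|C(0)| = ∞`, and the cluster `K` of `0` using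
lattice steps inside `S ∋ 0` is finite, then some site of `K` has an open lattice edge to a site
outside `S`. -/
theorem exists_exit {S : Set (Site 3)} (h0 : (0 : Site 3) ∈ S) {ω : BondConfig (Site 3)}
    (hωE : ω ⊆ (zdGraph 3).edgeSet) (hinf : ω ∈ percolatesAt (0 : Site 3))
    (hfin : (openClusterIn (withinGraph (zdGraph 3) S) ω 0).Finite) :
    ∃ a ∈ openClusterIn (withinGraph (zdGraph 3) S) ω 0, ∃ b ∉ S,
      (zdGraph 3).Adj a b ∧ s(a, b) ∈ ω := by
  obtain ⟨y, hyC, hyK⟩ : ∃ y ∈ openCluster ω (0 : Site 3),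
      y ∉ openClusterIn (withinGraph (zdGraph 3) S) ω 0 := by
    by_contra h
    push Not at h
    exact hinf (hfin.subset h)
  obtain ⟨w⟩ : (openGraph ω).Reachable 0 y := hyC
  obtain ⟨d, -, hdK, hdnK⟩ := w.exists_boundary_dart _ (self_mem_openClusterIn _ ω 0) hyK
  have hadj := (openGraph_adj ω _ _).1 d.adj
  have hG : (zdGraph 3).Adj d.fst d.snd := (SimpleGraph.mem_edgeSet (zdGraph 3)).1 (hωE hadj.1)
  refine ⟨d.fst, hdK, d.snd, fun hbS => hdnK ?_, hG, hadj.1⟩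
  exact mem_openClusterIn_of_adj hdK
    (withinGraph_adj.2 ⟨hG, openClusterIn_withinGraph_subset h0 ω hdK, hbS⟩) hadj.1

/-- **Uniqueness at the origin.** On the event "`ω ⊆ E(ℤ³)`, `|C(0)| = ∞`, the cluster of `0`
using lattice steps inside `S` is finite", any two functions that agree off `S` and are harmonic
for the open lattice edges at every site of `S` agree at the origin (Dirichlet uniqueness on the
finite cluster, from `maxPrinciple` applied to `v₁ - v₂` and `v₂ - v₁`). -/
theorem eq_of_harmonic {S : Set (Site 3)} (h0 : (0 : Site 3) ∈ S) {ω : BondConfig (Site 3)}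
    (hωE : ω ⊆ (zdGraph 3).edgeSet) (hinf : ω ∈ percolatesAt (0 : Site 3))
    (hfin : (openClusterIn (withinGraph (zdGraph 3) S) ω 0).Finite) {v₁ v₂ : Site 3 → ℝ}
    (hbdry : ∀ y : Site 3, y ∉ S → v₁ y = v₂ y)
    (hharm₁ : ∀ x ∈ S,
      ∑ y ∈ ((zdGraph 3).neighborFinset x).filter (fun y => s(x, y) ∈ ω), (v₁ y - v₁ x) = 0)
    (hharm₂ : ∀ x ∈ S,
      ∑ y ∈ ((zdGraph 3).neighborFinset x).filter (fun y => s(x, y) ∈ ω), (v₂ y - v₂ x) = 0) :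
    v₁ 0 = v₂ 0 := by
  have hexit := exists_exit h0 hωE hinf hfin
  have key : ∀ w₁ w₂ : Site 3 → ℝ, (∀ y : Site 3, y ∉ S → w₁ y = w₂ y) →
      (∀ x ∈ S, ∑ y ∈ ((zdGraph 3).neighborFinset x).filter (fun y => s(x, y) ∈ ω),
        (w₁ y - w₁ x) = 0) →
      (∀ x ∈ S, ∑ y ∈ ((zdGraph 3).neighborFinset x).filter (fun y => s(x, y) ∈ ω),
        (w₂ y - w₂ x) = 0) → w₁ 0 ≤ w₂ 0 := by
    intro w₁ w₂ hb h₁ h₂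
    have hout : ∀ y : Site 3, y ∉ S → w₁ y - w₂ y = 0 := fun y hy => by rw [hb y hy, sub_self]
    have hh : ∀ x ∈ S, ∑ y ∈ ((zdGraph 3).neighborFinset x).filter (fun y => s(x, y) ∈ ω),
        ((w₁ y - w₂ y) - (w₁ x - w₂ x)) = 0 := by
      intro x hx
      have e : ∀ y, (w₁ y - w₂ y) - (w₁ x - w₂ x) = (w₁ y - w₁ x) - (w₂ y - w₂ x) :=
        fun y => by ring
      simp only [e, Finset.sum_sub_distrib, h₁ x hx, h₂ x hx, sub_zero]
    have h := maxPrinciple (u := fun x => w₁ x - w₂ x) h0 hfin hout hh hexit 0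
      (self_mem_openClusterIn _ ω 0)
    linarith
  exact le_antisymm (key v₁ v₂ hbdry hharm₁ hharm₂)
    (key v₂ v₁ (fun y hy => (hbdry y hy).symm) hharm₂ hharm₁)

/-! ### Reflected voltages -/

/-- **Reflected voltages are harmonic.** Let `r` be a lattice automorphism preserving `S` and
`R = BondConfig.relabel (sym2Equiv r)` the induced relabelling of configurations. If `v'` is
harmonic for the open lattice edges of `R ω` at every site of `S`, then `x ↦ 1 - v' (r x)` is
harmonic for the open lattice edges of `ω` at every site of `S`. -/
theorem reflect_harmonic {S : Set (Site 3)} (r : Site 3 ≃ Site 3) (hrS : ∀ x, r x ∈ S ↔ x ∈ S)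
    (hadj : ∀ x y, (zdGraph 3).Adj (r x) (r y) ↔ (zdGraph 3).Adj x y)
    {ω : BondConfig (Site 3)} {v' : Site 3 → ℝ}
    (hharm' : ∀ x ∈ S, ∑ y ∈ ((zdGraph 3).neighborFinset x).filter
      (fun y => s(x, y) ∈ BondConfig.relabel (sym2Equiv r) ω), (v' y - v' x) = 0)
    (x : Site 3) (hx : x ∈ S) :
    ∑ y ∈ ((zdGraph 3).neighborFinset x).filter (fun y => s(x, y) ∈ ω),
      ((1 - v' (r y)) - (1 - v' (r x))) = 0 := by
  have h := hharm' (r x) ((hrS x).2 hx)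
  have hsum : ∑ y ∈ ((zdGraph 3).neighborFinset x).filter (fun y => s(x, y) ∈ ω),
      (v' (r y) - v' (r x)) =
      ∑ y ∈ ((zdGraph 3).neighborFinset (r x)).filter
        (fun y => s(r x, y) ∈ BondConfig.relabel (sym2Equiv r) ω), (v' y - v' (r x)) := by
    refine Finset.sum_equiv r (fun y => ?_) (fun y _ => rfl)
    simp only [Finset.mem_filter, SimpleGraph.mem_neighborFinset, hadj, mk_mem_relabel_iff]
  calc ∑ y ∈ ((zdGraph 3).neighborFinset x).filter (fun y => s(x, y) ∈ ω),
        ((1 - v' (r y)) - (1 - v' (r x)))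
      = ∑ y ∈ ((zdGraph 3).neighborFinset x).filter (fun y => s(x, y) ∈ ω),
          (-(v' (r y) - v' (r x))) := Finset.sum_congr rfl (fun y _ => by ring)
    _ = -∑ y ∈ ((zdGraph 3).neighborFinset x).filter (fun y => s(x, y) ∈ ω),
          (v' (r y) - v' (r x)) := Finset.sum_neg_distrib _
    _ = 0 := by rw [hsum, h, neg_zero]

/-- **Reflection identity.** Let `r` be a lattice automorphism of `ℤ³` negating the height and
fixing `0`, `R` the induced relabelling of configurations, and `v` a selection of slab voltages
for the symmetric slab `(-n, n)` (plate values and harmonicity for every configuration). On the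
event "`ω ⊆ E(ℤ³)`, `|C(0)| = ∞`, `0` does not percolate using lattice steps inside the open slab"
one has `v ω 0 + v (R ω) 0 = 1`: both `v ω` and `x ↦ 1 - v (R ω) (r x)` are slab voltages for
`ω`, hence agree at `0 = r 0` (`eq_of_harmonic`). -/
theorem sum_reflect_eq_one {n : ℕ} (hn : 0 < n) (r : Site 3 ≃ Site 3)
    (hr : ∀ x : Site 3, (r x) 0 = -(x 0)) (hr0 : r 0 = 0)
    (hadj : ∀ x y, (zdGraph 3).Adj (r x) (r y) ↔ (zdGraph 3).Adj x y)
    {v : BondConfig (Site 3) → Site 3 → ℝ}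
    (htop : ∀ ω (x : Site 3), (n : ℤ) ≤ x 0 → v ω x = 1)
    (hbot : ∀ ω (x : Site 3), x 0 ≤ -(n : ℤ) → v ω x = 0)
    (hharm : ∀ ω (x : Site 3), -(n : ℤ) < x 0 → x 0 < (n : ℤ) →
      ∑ y ∈ ((zdGraph 3).neighborFinset x).filter (fun y => s(x, y) ∈ ω), (v ω y - v ω x) = 0)
    {ω : BondConfig (Site 3)} (hωE : ω ⊆ (zdGraph 3).edgeSet) (hinf : ω ∈ percolatesAt (0 : Site 3))
    (hfin : ω ∉ percolatesVia (withinGraph (zdGraph 3)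
      {z : Site 3 | -(n : ℤ) < z 0 ∧ z 0 < (n : ℤ)}) (0 : Site 3)) :
    v ω 0 + v (BondConfig.relabel (sym2Equiv r) ω) 0 = 1 := by
  have hfin' : (openClusterIn (withinGraph (zdGraph 3)
      {z : Site 3 | -(n : ℤ) < z 0 ∧ z 0 < (n : ℤ)}) ω 0).Finite := Set.not_infinite.1 hfin
  have h0 : (0 : Site 3) ∈ {z : Site 3 | -(n : ℤ) < z 0 ∧ z 0 < (n : ℤ)} := by
    simp only [Set.mem_setOf_eq, Pi.zero_apply]
    exact ⟨by omega, by omega⟩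
  have hrS : ∀ x : Site 3, r x ∈ {z : Site 3 | -(n : ℤ) < z 0 ∧ z 0 < (n : ℤ)} ↔
      x ∈ {z : Site 3 | -(n : ℤ) < z 0 ∧ z 0 < (n : ℤ)} := fun x => by
    simp only [Set.mem_setOf_eq, hr]
    constructor <;> rintro ⟨h1, h2⟩ <;> exact ⟨by omega, by omega⟩
  -- boundary values: the two candidate voltages agree off the open slab
  have hbdry : ∀ y : Site 3, y ∉ {z : Site 3 | -(n : ℤ) < z 0 ∧ z 0 < (n : ℤ)} →
      v ω y = 1 - v (BondConfig.relabel (sym2Equiv r) ω) (r y) := by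
    intro y hy
    simp only [Set.mem_setOf_eq, not_and_or, not_lt] at hy
    rcases hy with hy | hy
    · rw [hbot ω y hy, htop _ (r y) (by rw [hr]; omega), sub_self]
    · rw [htop ω y hy, hbot _ (r y) (by rw [hr]; omega), sub_zero]
  have hharm₁ : ∀ x ∈ {z : Site 3 | -(n : ℤ) < z 0 ∧ z 0 < (n : ℤ)},
      ∑ y ∈ ((zdGraph 3).neighborFinset x).filter (fun y => s(x, y) ∈ ω), (v ω y - v ω x) = 0 :=
    fun x hx => hharm ω x hx.1 hx.2
  have hharm' : ∀ x ∈ {z : Site 3 | -(n : ℤ) < z 0 ∧ z 0 < (n : ℤ)},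
      ∑ y ∈ ((zdGraph 3).neighborFinset x).filter
        (fun y => s(x, y) ∈ BondConfig.relabel (sym2Equiv r) ω),
        (v (BondConfig.relabel (sym2Equiv r) ω) y - v (BondConfig.relabel (sym2Equiv r) ω) x) = 0 :=
    fun x hx => hharm _ x hx.1 hx.2
  have hharm₂ := reflect_harmonic r hrS hadj hharm'
  have h := eq_of_harmonic (v₁ := v ω) (v₂ := fun x => 1 - v (BondConfig.relabel (sym2Equiv r) ω) (r x))
    h0 hωE hinf hfin' hbdry hharm₁ hharm₂
  simp only [hr0] at h
  linarith

/-! ### The events -/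

/-- The lattice edges with both endpoints in the open slab are the edges of the slab step graph
`withinGraph (zdGraph 3) {z | -n < z 0 ∧ z 0 < n}`. -/
theorem edgeSet_slab (n : ℕ) :
    {e : Sym2 (Site 3) | e ∈ (zdGraph 3).edgeSet ∧ ∀ z ∈ e, -(n : ℤ) < z 0 ∧ z 0 < (n : ℤ)} =
      (withinGraph (zdGraph 3) {z : Site 3 | -(n : ℤ) < z 0 ∧ z 0 < (n : ℤ)}).edgeSet := by
  ext e
  induction e using Sym2.ind with
  | _ a b =>
    simp only [Set.mem_setOf_eq, SimpleGraph.mem_edgeSet, withinGraph_adj, Sym2.mem_iff,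
      forall_eq_or_imp, forall_eq]

/-- The subtracted event of the statement is `{0 ↔ ∞ via the slab step graph}`
(`percolatesVia`, cf. `percolatesVia_eq_preimage`). -/
theorem slabEvent_eq (n : ℕ) :
    {ω : BondConfig (Site 3) | ω ∩ {e : Sym2 (Site 3) | e ∈ (zdGraph 3).edgeSet ∧
      ∀ z ∈ e, -(n : ℤ) < z 0 ∧ z 0 < (n : ℤ)} ∈ percolatesAt (0 : Site 3)} =
      percolatesVia (withinGraph (zdGraph 3) {z : Site 3 | -(n : ℤ) < z 0 ∧ z 0 < (n : ℤ)})
        (0 : Site 3) := by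
  rw [edgeSet_slab]
  rfl

/-- The event `{0 ↔ ∞} \ {0 ↔ ∞ via lattice steps inside S}` is invariant under the relabelling
induced by a lattice automorphism `r` fixing `0` and preserving `S`. -/
theorem refl_preimage_event {S : Set (Site 3)} (r : Site 3 ≃ Site 3) (hr0 : r 0 = 0)
    (hrS : ∀ x, r x ∈ S ↔ x ∈ S) (hadj : ∀ x y, (zdGraph 3).Adj (r x) (r y) ↔ (zdGraph 3).Adj x y) :
    BondConfig.relabel (sym2Equiv r) ⁻¹'
        (percolatesAt (0 : Site 3) \ percolatesVia (withinGraph (zdGraph 3) S) (0 : Site 3)) =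
      percolatesAt (0 : Site 3) \ percolatesVia (withinGraph (zdGraph 3) S) (0 : Site 3) := by
  have hW : ∀ u w : Site 3, (withinGraph (zdGraph 3) S).Adj (r u) (r w) ↔
      (withinGraph (zdGraph 3) S).Adj u w := fun u w => by
    rw [withinGraph_adj, withinGraph_adj, hadj, hrS, hrS]
  ext ω
  simp only [Set.mem_preimage, Set.mem_sdiff]
  have h1 := relabel_mem_percolatesAt_iff r ω 0
  have h2 := relabel_mem_percolatesVia_iff r (K := withinGraph (zdGraph 3) S)
    (K' := withinGraph (zdGraph 3) S) hW ω 0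
  rw [hr0] at h1 h2
  rw [h1, h2]

end SymmetricSlab

open SymmetricSlab in
/-- **Item stmt-CriticalPhenomena-10643 (`SymmetricSlabCalibration`).** For every `p`, every
`n > 0` and every measurable selection of slab voltages `v` for the symmetric slab `(-n, n)`,
`(θ(p) - P_p(0 ↔ ∞ inside the open slab)) / 2 ≤ ∫_{0 ↔ ∞} v(ω, 0) dP_p`: on
`A = {0 ↔ ∞} \ {0 ↔ ∞ inside the slab}` the slab cluster of `0` is finite and touches a plate, so
by the maximum principle `v(ω,0) + v(Rω,0) = 1` (`R` the reflection `x₀ ↦ -x₀`), and `P_p`, `A` are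
`R`-invariant, giving `∫_A v = P_p(A)/2`; finally `∫_{0↔∞} v ≥ ∫_A v` since `v ≥ 0`. -/
theorem symmetricSlabCalibration_proof : Theses.PercGamblersRuin.SymmetricSlabCalibration := by
  intro p n hn v hmeas hbounds htop hbot hharm
  rw [slabEvent_eq n]
  -- the reflection `x₀ ↦ -x₀`: height-negating, fixes `0`, lattice automorphism, preserves `P_p`
  obtain ⟨r, hr, hr0, hadj, hmap⟩ : ∃ r : Site 3 ≃ Site 3, (∀ x : Site 3, (r x) 0 = -(x 0)) ∧
      r 0 = 0 ∧ (∀ x y, (zdGraph 3).Adj (r x) (r y) ↔ (zdGraph 3).Adj x y) ∧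
      Measure.map (BondConfig.relabel (sym2Equiv r)) (bondPercolation (zdGraph 3) p) =
        bondPercolation (zdGraph 3) p :=
    ⟨Site.signedPerm (d := 3) (Equiv.refl (Fin 3)) (Function.update 1 0 (-1)), refl_apply_zero,
      Site.signedPerm_zero _ _, adj_refl_iff,
      bondPercolation_map_relabel_iso
        (zdSignedPermIso (d := 3) (Equiv.refl (Fin 3)) (Function.update 1 0 (-1))) p⟩
  have hrS : ∀ x : Site 3, r x ∈ {z : Site 3 | -(n : ℤ) < z 0 ∧ z 0 < (n : ℤ)} ↔
      x ∈ {z : Site 3 | -(n : ℤ) < z 0 ∧ z 0 < (n : ℤ)} := fun x => by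
    simp only [Set.mem_setOf_eq, hr]
    constructor <;> rintro ⟨h1, h2⟩ <;> exact ⟨by omega, by omega⟩
  -- names for the two events and the measure
  have hBm : MeasurableSet (percolatesVia (withinGraph (zdGraph 3)
      {z : Site 3 | -(n : ℤ) < z 0 ∧ z 0 < (n : ℤ)}) (0 : Site 3)) :=
    measurableSet_percolatesVia _ 0
  have hBsub : percolatesVia (withinGraph (zdGraph 3)
      {z : Site 3 | -(n : ℤ) < z 0 ∧ z 0 < (n : ℤ)}) (0 : Site 3) ⊆ percolatesAt 0 :=
    percolatesVia_subset_percolatesAt _ 0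
  have hinv := refl_preimage_event r hr0 hrS hadj
  set B := percolatesVia (withinGraph (zdGraph 3)
      {z : Site 3 | -(n : ℤ) < z 0 ∧ z 0 < (n : ℤ)}) (0 : Site 3) with hBdef
  set A := percolatesAt (0 : Site 3) \ B with hAdef
  set P := bondPercolation (zdGraph 3) p with hPdef
  have hAm : MeasurableSet A := (measurableSet_percolatesAt_holds 0).diff hBm
  have hθ : theta (zdGraph 3) 0 p - P.real B = P.real A := by
    rw [hAdef, measureReal_sdiff hBsub hBm, theta]
  have hmp : MeasurePreserving (BondConfig.relabel (sym2Equiv r)) P P :=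
    ⟨(BondConfig.relabel (sym2Equiv r)).measurable, hmap⟩
  -- integrability of the two bounded integrands
  have hint : Integrable (fun ω => v ω 0) P :=
    Integrable.of_bound hmeas.aestronglyMeasurable 1 (Eventually.of_forall fun ω => by
      rw [Real.norm_eq_abs, abs_of_nonneg (hbounds ω 0).1]
      exact (hbounds ω 0).2)
  have hmeasR : Measurable (fun ω => v (BondConfig.relabel (sym2Equiv r) ω) 0) :=
    hmeas.comp (BondConfig.relabel (sym2Equiv r)).measurable
  have hintR : Integrable (fun ω => v (BondConfig.relabel (sym2Equiv r) ω) 0) P :=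
    Integrable.of_bound hmeasR.aestronglyMeasurable 1 (Eventually.of_forall fun ω => by
      rw [Real.norm_eq_abs, abs_of_nonneg (hbounds _ 0).1]
      exact (hbounds _ 0).2)
  -- `∫_A v(R ·, 0) = ∫_A v(·, 0)`
  have hswap : ∫ ω in A, v (BondConfig.relabel (sym2Equiv r) ω) 0 ∂P = ∫ ω in A, v ω 0 ∂P := by
    have h := hmp.setIntegral_preimage_emb (BondConfig.relabel (sym2Equiv r)).measurableEmbedding
      (fun ω => v ω 0) A
    rw [hinv] at h
    exact h
  -- `v(ω,0) + v(Rω,0) = 1` almost surely on `A`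
  have hae : ∀ᵐ ω ∂(P.restrict A), v ω 0 + v (BondConfig.relabel (sym2Equiv r) ω) 0 = (1 : ℝ) := by
    have h1 : ∀ᵐ ω ∂(P.restrict A), ω ⊆ (zdGraph 3).edgeSet :=
      ae_restrict_of_ae ProbabilityTheory.setBernoulli_ae_subset
    have h2 : ∀ᵐ ω ∂(P.restrict A), ω ∈ A := ae_restrict_mem hAm
    filter_upwards [h1, h2] with ω hωE hωA
    exact sum_reflect_eq_one hn r hr hr0 hadj htop hbot hharm hωE hωA.1 hωA.2
  have hsum : ∫ ω in A, (v ω 0 + v (BondConfig.relabel (sym2Equiv r) ω) 0) ∂P = P.real A := by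
    rw [integral_congr_ae hae, setIntegral_const, smul_eq_mul, mul_one]
  have hadd : ∫ ω in A, (v ω 0 + v (BondConfig.relabel (sym2Equiv r) ω) 0) ∂P =
      ∫ ω in A, v ω 0 ∂P + ∫ ω in A, v (BondConfig.relabel (sym2Equiv r) ω) 0 ∂P :=
    integral_add hint.integrableOn hintR.integrableOn
  have hhalf : ∫ ω in A, v ω 0 ∂P = P.real A / 2 := by linarith
  have hmono : ∫ ω in A, v ω 0 ∂P ≤ ∫ ω in percolatesAt (0 : Site 3), v ω 0 ∂P :=
    setIntegral_mono_set hint.integrableOn (ae_of_all _ fun ω => (hbounds ω 0).1)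
      (Eventually.of_forall fun ω (hω : ω ∈ A) => hω.1)
  calc (theta (zdGraph 3) 0 p - P.real B) / 2 = P.real A / 2 := by rw [hθ]
    _ = ∫ ω in A, v ω 0 ∂P := hhalf.symm
    _ ≤ ∫ ω in percolatesAt (0 : Site 3), v ω 0 ∂P := hmono

end Summit.CriticalPhenomena.PercolationContinuityZ3.Theorems

end
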